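import Summits.BirchSwinnertonDyer.Rank1Residual.Additive.FouquetWanLocus
import Literature.NumberTheory.EllipticCurves.MazurTorsionGaloisStructureProofs
import HarnessLib

/-!
# Route `AdditiveKolyvaginRoad`: NO `F`-RATIONAL `p`-TORSION WHEN `ρ̄_{E,p}|Γ_F` IS IRREDUCIBLE — and the local binder
# `#E(ℚ_p)[p] = 1` on the `LocIrr` locus (first lemma FL-1 of crux card `universal-zeta-transport-anchor` on KS′
# `LevelKolyvaginSystemsAdditive`, item stmt-BirchSwinnertonDyer-21396; cell `pub/bsd-wall`, width seat `bsd-wall-akr-p2x-w4` g4; helper)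

THEOREMS ONLY (no definition, no named fact, no `sorry`).  BSD is not proved by any of this; KS′ and KPA′ stay OPEN at `p² ∣ N`; the
card's transfer statement is untouched — only its «locus lemma» FL-1 is proved.

THE POINT.  Several refereed inputs used on this summit carry the LOCAL binder «`E(ℚ_p)[p] = 0`» in the shape
`Nat.card {Q : (W.baseChange ℚ_[p]).toAffine.Point // (p : ℕ) • Q = 0} = 1` — the (t0) hypothesis of
`Kim2026.rankZero_le_padicValNat_sha_of_kuriharaNumber_ne_zero_of_localTorsionTrivial`, Kim–Nakamura's non-exceptionality, the PLANE
count `#H¹(ℚ_p, E[p]) = p²` of the Lagrangian switch (`LagrangianSwitchAtP.natCard_localH1_rat_eq_sq`).  The crux-ideation card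
`Cruxes/LevelKolyvaginSystemsAdditive/Ideas/universal-zeta-transport-anchor.md` records (FL-1, «provable now») that on the Fouquet–Wan locus
`LocIrr W p` («`E[p]` is an irreducible `G_{ℚ_p}`-module», `Rank1Residual/Additive/FouquetWanLocus.lean`) the binder is AUTOMATIC:
`E(ℚ_p)[p] ⊂ E[p]^{G_{ℚ_p}} = 0`.  (It is NOT automatic at every additive `p`: `X₁(5)`-fibres on Kodaira type II have `E(ℚ₅)[5] ≠ 0`;
canonical-subgroup frames 294g1@7, 350c1@5, 490g1@7 — the card's erratum to its own earlier «∀ SubTprime» form.)  The tree has Mazur's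
argument «a rational point of prime order `N` spans a `Γ`-stable line, so `ρ̄_N` is reducible» over `ℚ`
(`natCard_torsionBy_eq_one_of_hasIrreducibleModPGaloisRep`, `exists_geomTorsion_of_addOrderOf_eq`) and its second half over ANY field
(`not_hasIrreducibleModPGaloisRep_of_smul_eq`).  This file supplies the first half over any field and concludes:

* §1 `exists_geomTorsion_ne_zero_fixed_of_nsmul_eq_zero` — over any field `F`: a non-zero `F`-rational `Q` with `p • Q = 0` gives a
  non-zero `Γ_F`-FIXED element of `E[p] = E(F̄)[p]` (its image under `E(F) → E(F̄)`).
* §2 `eq_zero_of_nsmul_eq_zero_of_hasIrreducibleModPGaloisRep` ∕ `natCard_nsmulTorsion_eq_one_of_hasIrreducibleModPGaloisRep` — over any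
  field `F` with `(p : F) ≠ 0`: `ρ̄_{E,p}` irreducible as a `Γ_F`-module ⟹ `E(F)[p] = 0`, i.e. `#{Q ∈ E(F) : p • Q = 0} = 1`.
* §3 `localTorsionTrivialOfLocIrr` — FL-1 VERBATIM (the card's `LocalTorsionTrivialOfLocIrr`, binders `5 ≤ p`, `Addv W p` carried but
  idle): `LocIrr W p → Nat.card {Q : (W.baseChange ℚ_[p]).toAffine.Point // (p : ℕ) • Q = 0} = 1`; and `localTorsionTrivial_of_locIrr`
  without the idle binders (any prime `p`, any `W/ℚ`).

References: B. Mazur, *Modular curves and the Eisenstein ideal*, Publ. Math. IHÉS 47 (1977), Ch. III §5, p. 157; O. Fouquet, X. Wan,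
arXiv:2107.13726 Thm. 5.1 (the locus); C.-H. Kim, arXiv:2203.12161 (the binder).
-/

-- D-0017: single-problem summit, so `Summit.BirchSwinnertonDyer.BirchSwinnertonDyer.…` repeats a namespace BY DESIGN.
set_option linter.dupNamespace false
set_option autoImplicit false

noncomputable section

open scoped Classical

open WeierstrassCurve Field
  Literature.NumberTheory.EllipticCurves Literature.NumberTheory.GaloisRepresentations
  Literature.NumberTheory.EllipticCurves.Rank1Residual
  Summit.BirchSwinnertonDyer.Rank1Residual.Additive

namespace Summit.BirchSwinnertonDyer.BirchSwinnertonDyer.Theorems.AdditiveKoly.LocalTorsion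

universe u

/-! ## §1 A rational `p`-torsion point gives a `Γ_F`-fixed point of `E[p]` (any field) -/

/-- **The geometric point of an `F`-rational `p`-torsion point** (any field `F`): for `Q ∈ E(F)`, `Q ≠ O`, `p • Q = O`, the image of
`Q` under `E(F) → E(F̄)` (Mathlib's `Affine.Point.map` along `F → F̄`) lies in `E[p] = E(F̄)[p]`, is non-zero (the map is injective) and is
fixed by `Γ_F` (every `σ ∈ Gal(F̄/F)` commutes with `F → F̄`).  The tree's `exists_geomTorsion_of_addOrderOf_eq` is the case `F = ℚ`
(stated with `addOrderOf`). [cite: Mazur1977, Ch. III §5, p. 157] -/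
theorem exists_geomTorsion_ne_zero_fixed_of_nsmul_eq_zero {F : Type u} [Field F] (W : WeierstrassCurve F) [W.IsElliptic]
    (p : ℕ) {Q : W.toAffine.Point} (hQ0 : Q ≠ 0) (hQ : (p : ℕ) • Q = 0) :
    ∃ Pb : geomTorsion W (p : ℤ), Pb ≠ 0 ∧ ∀ σ : absoluteGaloisGroup F, σ • Pb = Pb := by
  set ι : W.toAffine.Point →+ geomPoints W :=
    Affine.Point.map (W' := W.toAffine) (S := F) (Algebra.ofId F (AlgebraicClosure F)) with hι
  have hinj : Function.Injective ι :=
    Affine.Point.map_injective (W' := W.toAffine) (f := Algebra.ofId F (AlgebraicClosure F))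
  have hpQ : (p : ℤ) • Q = 0 := by rw [natCast_zsmul]; exact hQ
  have hmem : ι Q ∈ geomTorsion W (p : ℤ) := by
    rw [mem_torsionBy_iff, ← map_zsmul, hpQ, map_zero]
  refine ⟨⟨ι Q, hmem⟩, fun h0 ↦ ?_, fun σ ↦ Subtype.ext ?_⟩
  · have h : ι Q = ι 0 := by rw [map_zero]; exact congrArg Subtype.val h0
    exact hQ0 (hinj h)
  · let σ' : AlgebraicClosure F ≃ₐ[F] AlgebraicClosure F := σ
    have h1 := Affine.Point.map_map (W' := W.toAffine) (S := F)
      (Algebra.ofId F (AlgebraicClosure F)) (σ' : AlgebraicClosure F →ₐ[F] AlgebraicClosure F) Q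
    have h2 : (σ' : AlgebraicClosure F →ₐ[F] AlgebraicClosure F).comp
        (Algebra.ofId F (AlgebraicClosure F)) = Algebra.ofId F (AlgebraicClosure F) :=
      Subsingleton.elim _ _
    rw [h2] at h1
    exact h1

/-! ## §2 `ρ̄_{E,p}|Γ_F` irreducible ⟹ `E(F)[p] = 0` (any field with `p ≠ 0` in `F`) -/

/-- **No `F`-rational `p`-torsion when `E[p]` is an irreducible `Γ_F`-module** (any field `F` with `(p : F) ≠ 0`, `p` prime): a
non-zero `Q ∈ E(F)` with `p • Q = O` would give a non-zero `Γ_F`-fixed `P̄ ∈ E[p]` (§1), whose line `⟨P̄⟩ ≅ ℤ/p` is a `Γ_F`-stable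
subgroup other than `⊥`, `⊤` (`#E[p] = p²`) — Mazur's «the representation has the form `(1 *; 0 χ)`», tree
`not_hasIrreducibleModPGaloisRep_of_smul_eq`. [cite: Mazur1977, Ch. III §5, p. 157 (display after (5.4))] -/
theorem eq_zero_of_nsmul_eq_zero_of_hasIrreducibleModPGaloisRep {F : Type u} [Field F] (W : WeierstrassCurve F) [W.IsElliptic]
    (p : ℕ) [Fact p.Prime] [NeZero (p : F)] (hirr : W.HasIrreducibleModPGaloisRep p)
    (Q : W.toAffine.Point) (hQ : (p : ℕ) • Q = 0) : Q = 0 := by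
  by_contra hQ0
  obtain ⟨Pb, hPb0, hfix⟩ := exists_geomTorsion_ne_zero_fixed_of_nsmul_eq_zero W p hQ0 hQ
  exact not_hasIrreducibleModPGaloisRep_of_smul_eq W p hPb0 hfix hirr

/-- **`#{Q ∈ E(F) : p • Q = O} = 1`** when `E[p]` is an irreducible `Γ_F`-module (`(p : F) ≠ 0`) — the previous theorem in the
`Nat.card` currency of the tree's local binders. [cite: Mazur1977, Ch. III §5, p. 157] -/
theorem natCard_nsmulTorsion_eq_one_of_hasIrreducibleModPGaloisRep {F : Type u} [Field F] (W : WeierstrassCurve F)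
    [W.IsElliptic] (p : ℕ) [Fact p.Prime] [NeZero (p : F)] (hirr : W.HasIrreducibleModPGaloisRep p) :
    Nat.card {Q : W.toAffine.Point // (p : ℕ) • Q = 0} = 1 := by
  rw [Nat.card_eq_one_iff_unique]
  refine ⟨⟨fun x y ↦ Subtype.ext ?_⟩, ⟨⟨0, smul_zero _⟩⟩⟩
  rw [eq_zero_of_nsmul_eq_zero_of_hasIrreducibleModPGaloisRep W p hirr x.1 x.2,
    eq_zero_of_nsmul_eq_zero_of_hasIrreducibleModPGaloisRep W p hirr y.1 y.2]

/-! ## §3 FL-1: on the `LocIrr` locus `E(ℚ_p)[p] = 0` -/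

/-- **`LocIrr ⟹ E(ℚ_p)[p] = 0`** for any `E/ℚ` and any prime `p`: if `E[p]` is an irreducible `G_{ℚ_p}`-module
(`LocIrr W p := (W.baseChange ℚ_[p]).HasIrreducibleModPGaloisRep p`) then `#{Q ∈ E(ℚ_p) : p • Q = O} = 1` — §2 over `F = ℚ_p`
(characteristic `0`).  This is the (t0) binder `Nat.card {Q : (W.baseChange ℚ_[p]).toAffine.Point // (p : ℕ) • Q = 0} = 1` of
`Kim2026.rankZero_le_padicValNat_sha_of_kuriharaNumber_ne_zero_of_localTorsionTrivial` (and of Kim–Nakamura's non-exceptionality),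
discharged on the Fouquet–Wan locus. [cite: Mazur1977, Ch. III §5, p. 157] [cite: FouquetWan2021, Thm. 5.1 (second hypothesis)] -/
theorem localTorsionTrivial_of_locIrr (W : WeierstrassCurve ℚ) [W.IsElliptic] (p : ℕ) [Fact p.Prime] (hL : LocIrr W p) :
    Nat.card {Q : (W.baseChange ℚ_[p]).toAffine.Point // (p : ℕ) • Q = 0} = 1 := by
  haveI : (W.baseChange ℚ_[p]).IsElliptic := by
    rw [WeierstrassCurve.baseChange]; infer_instance
  haveI : NeZero ((p : ℕ) : ℚ_[p]) := ⟨Nat.cast_ne_zero.mpr (Fact.out : p.Prime).ne_zero⟩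
  exact natCard_nsmulTorsion_eq_one_of_hasIrreducibleModPGaloisRep (W.baseChange ℚ_[p]) p hL

/-- **FL-1 of crux card `universal-zeta-transport-anchor`, VERBATIM** (the card's `LocalTorsionTrivialOfLocIrr`, with its frame
binders `5 ≤ p`, `Addv W p`, global minimality carried but idle): on an additive frame with `E[p]` irreducible as a `G_{ℚ_p}`-module,
`#E(ℚ_p)[p] = 1`. [cite: Mazur1977, Ch. III §5, p. 157] [cite: FouquetWan2021, Thm. 5.1 (second hypothesis)] -/
theorem localTorsionTrivialOfLocIrr (W : WeierstrassCurve ℚ) [W.IsElliptic] [W.IsGloballyMinimal] (p : ℕ) [Fact p.Prime]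
    (_hp5 : 5 ≤ p) (_hadd : Addv W p) (hL : LocIrr W p) :
    Nat.card {Q : (W.baseChange ℚ_[p]).toAffine.Point // (p : ℕ) • Q = 0} = 1 :=
  localTorsionTrivial_of_locIrr W p hL

end Summit.BirchSwinnertonDyer.BirchSwinnertonDyer.Theorems.AdditiveKoly.LocalTorsion

end
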